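import Summits.CriticalPhenomena.PercolationContinuityZ3.Theorems.PercNearOneGluingNoHeavyQuantFarLayerOneTreeObserverAll
import Summits.CriticalPhenomena.PercolationContinuityZ3.Theorems.PercNearOneGluingNoHeavyQuantFarSunRowLeSeven
import HarnessLib

/-!
# QUANT lane R8, front "FAR beyond trees" — layer one from any tree observer with the sun hypothesis AT `|A|` ONLY; UNCONDITIONAL for `|A| ≤ 7`

builds on p205010 (kernel theorem, internal audit signed; external expert review pending)

Support file (`--supports stmt-CriticalPhenomena-4575`, COMPUTATIONAL because of the `|A| ≤ 7` corollary resting on prim-cert-1's `native_decide` sun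
certificates), seat `prim-quant-p1` (gen 18); memo `run/shared/lean/prim/quant/prim-quant-p1-g18/FOR-PROVERS-FLATTENING-FC.md` §1 (R6).  No definitions; no sorries.

* `Quant.Bundle.layerOne_of_pforest_treeObs` — the induction of `…QuantFarLayerOneTreeObserverAll` with the hypothesis `SunFAR |A| 1` only
  (base case through `Bundle.farp_one_of_pforest`);
* **`Quant.Bundle.layerOne_of_pforest_treeObs_of_card_le_seven`** — layer one of FAR from ANY tree observer of a pendant forest on a cycle with at most
  seven relays, UNCONDITIONALLY (`HairyCycle.sunFAR_of_le_seven`).  With `layerOne_of_pforest_of_card_le_seven` (observer on the cycle): every observer.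
[cite: KozmaNitzan2024, Conjecture 3 (p. 15)]; [this work].
-/

noncomputable section

namespace Summit.CriticalPhenomena.PercolationContinuityZ3.Theorems

namespace Quant

namespace Bundle

open Finset MeasureTheory Set
open Literature.Probability.LatticeModels
open Literature.Probability.Percolation
open Summit.CriticalPhenomena.PercolationContinuityZ3.Theorems.HairyCycle (SunFAR)
open scoped Classical

variable {n : ℕ}

section TreeObsCard

variable {L : ℕ} {cyc : ℕ → Fin n} {idx : Fin n → ℕ}

/-- **Layer one of FAR from a TREE observer** of a pendant forest on a cycle whose tree hangs at `c_0`, given `SunFAR |A| 1` only.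
Induction on `|T| + (length of the stalk from o to c_0)`. [this work] -/
theorem layerOne_of_pforest_treeObs (A : Finset (Fin n)) (hS : SunFAR A.card 1) :
    ∀ (m : ℕ) (T : Finset (Fin n)) (par : Fin n → Fin n) (dep : Fin n → ℕ) (w : Sym2 (Fin n) → unitInterval) (o : Fin n) (k : ℕ),
      PForest L cyc idx T par dep w → T.card + k ≤ m → par^[k + 1] o = cyc 0 → (∀ j, j ≤ k → par^[j] o ∈ T) →
      (∀ a ∈ A, a ∈ T ∨ ∃ i, i < L ∧ a = cyc i) → ∀ t : ℝ,
      (2 : ℝ) < ∑ a ∈ A, (prodBernoulli w).real (openConn o a) →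
      (∀ a ∈ A, (prodBernoulli w).real (openConn o a : Set (BondConfig (Fin n)))ᶜ ≤ t) →
      (prodBernoulli w).real {ω : BondConfig (Fin n) | (A.filter fun a => ω ∈ openConn o a).card ≤ 1} ≤ t := by
  intro m
  induction m using Nat.strong_induction_on with
  | _ m IH =>
  intro T par dep w o k P hm hk hchain hA t hEN hcut
  have hmeas : ∀ U : Set (BondConfig (Fin n)), MeasurableSet U := fun U => (Set.toFinite U).measurableSet
  have hoT : o ∈ T := by simpa using hchain 0 (Nat.zero_le k)
  have hK : 2 ≤ A.card := by
    have hle : ∑ a ∈ A, (prodBernoulli w).real (openConn o a) ≤ ∑ _a ∈ A, (1 : ℝ) := sum_le_sum fun a _ => measureReal_le_one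
    rw [sum_const, nsmul_eq_mul, mul_one] at hle
    have : (2 : ℝ) < A.card := by linarith
    exact_mod_cast this.le
  -- (a) the observer is a relay
  by_cases hoA : o ∈ A
  · exact layerOne_of_observer_mem w A hoA t hEN hcut
  -- (b)/(c)/(d)
  by_cases h1 : ∃ a ∈ A, Below T par o a
  · by_cases h2 : ∃ b ∈ A, ¬ Below T par o b
    · -- (b) relays on both sides
      exact layerOne_of_pforest_treeObs_twoSides P hoT A h1 h2 t hEN hcut
    · -- (c) all relays below `o`
      push Not at h2
      exact layerOne_of_pforest_treeObs_allBelow P hoT A h2 hS t hEN hcut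
  push Not at h1
  -- (d) no relay below `o`
  by_cases hdesc : (T.filter fun v => Below T par o v).Nonempty
  · -- (d1) prune a deepest vertex below `o` (a non-relay leaf)
    obtain ⟨v, hvS, hvmax⟩ := (T.filter fun v => Below T par o v).exists_max_image dep hdesc
    have hvT : v ∈ T := (mem_filter.1 hvS).1
    have hvb : Below T par o v := (mem_filter.1 hvS).2
    have hvA : v ∉ A := fun h => h1 v h hvb
    have hleaf : ∀ d ∈ T, par d ≠ v := by
      intro d hd hdv
      have hdb : Below T par o d := below_of_par_below hd hdv hvb
      have h1' := hvmax d (mem_filter.2 ⟨hd, hdb⟩)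
      have h2' := P.dep_lt d hd (by rw [hdv]; exact hvT)
      rw [hdv] at h2'; omega
    have hov : o ≠ v := fun h => not_below_self P hoT (h ▸ hvb)
    have hpend := P.pendant_of_leaf hvT hleaf
    have P' : PForest L cyc idx (T.erase v) par dep (Function.update w s(v, par v) 0) := by
      refine ⟨P.hL, P.hcyc, P.hidx, fun i hi h => P.cyc_notMem i hi (mem_of_mem_erase h), ?_, ?_, ?_⟩
      · intro u hu
        have huT := mem_of_mem_erase hu
        rcases P.par_mem u huT with hp | hp
        · left; exact mem_erase.2 ⟨fun h => hleaf u huT h, hp⟩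
        · exact Or.inr hp
      · intro u hu hp; exact P.dep_lt u (mem_of_mem_erase hu) (mem_of_mem_erase hp)
      · intro x y hxy hw
        have hne : s(x, y) ≠ s(v, par v) := by
          intro h; rw [h, Function.update_self] at hw; exact hw rfl
        rw [Function.update_of_ne hne] at hw
        rcases P.supp x y hxy hw with h | ⟨hx, h⟩ | ⟨hy, h⟩
        · exact Or.inl h
        · right; left
          refine ⟨mem_erase.2 ⟨fun hxc => hne ?_, hx⟩, h⟩
          subst hxc; rw [h]
        · right; right
          refine ⟨mem_erase.2 ⟨fun hyc => hne ?_, hy⟩, h⟩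
          subst hyc; rw [h, Sym2.eq_swap]
    -- the stalk of `o` avoids `v` (rankings)
    have hov' : ∀ j, j ≤ k → par^[j] o ≠ v := by
      intro j hj h
      have h1' := dep_chain_le P hchain j hj
      have h2' := dep_lt_of_below P hoT hvb
      rw [h] at h1'; omega
    have hchain' : ∀ j, j ≤ k → par^[j] o ∈ T.erase v := fun j hj => mem_erase.2 ⟨hov' j hj, hchain j hj⟩
    have hA' : ∀ a ∈ A, a ∈ T.erase v ∨ ∃ i, i < L ∧ a = cyc i := by
      intro a ha
      rcases hA a ha with h | h
      · left; exact mem_erase.2 ⟨fun hav => hvA (hav ▸ ha), h⟩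
      · exact Or.inr h
    have hm' : (T.erase v).card + k < m := by rw [card_erase_of_mem hvT]; have := card_pos.2 ⟨v, hvT⟩; omega
    have key : TwoCopy.FARp (Function.update w s(v, par v) 0) A o 1 :=
      fun hEN' t' hcut' => IH _ hm' (T.erase v) par dep _ o k P' le_rfl hk hchain' hA' t' (by push_cast at hEN'; linarith) hcut'
    exact ((TwoCopy.farp_iff_of_pendant w A o 1 (P.par_ne hvT) hvA hov hpend).2 key) (by push_cast; linarith) t hcut
  · -- (d2) `o` is a leaf: move the observer to `par o`
    rw [Finset.not_nonempty_iff_eq_empty] at hdesc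
    have hleafo : ∀ c ∈ T, par c ≠ o := by
      intro c hc hco
      have : c ∈ T.filter fun v => Below T par o v := mem_filter.2 ⟨hc, below_of_par_eq hc hco⟩
      rw [hdesc] at this; exact absurd this (Finset.notMem_empty c)
    have hpend : ∀ x : Fin n, x ≠ o → x ≠ par o → w s(o, x) = 0 := P.pendant_of_leaf hoT hleafo
    refine layerOne_of_pendant_observer w (P.par_ne hoT).symm hpend A hoA (fun t' hEN' hcut' => ?_) t hEN hcut
    -- the instance at `par o`
    rcases Nat.eq_zero_or_pos k with hk0 | hkpos
    · -- `par o = c_0`: the on-cycle theorem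
      subst hk0
      have hpo : par o = cyc 0 := by simpa using hk
      rw [hpo] at hEN' hcut' ⊢
      by_cases h0A : cyc 0 ∈ A
      · exact layerOne_of_observer_mem w A h0A t' hEN' hcut'
      · exact farp_one_of_pforest A hS _ T par dep w P le_rfl hA h0A (by push_cast; linarith) t' hcut'
    · -- `par o ∈ T`: induction (shorter stalk)
      obtain ⟨k', rfl⟩ : ∃ k', k = k' + 1 := ⟨k - 1, by omega⟩
      have hk' : par^[k' + 1] (par o) = cyc 0 := by rw [← Function.iterate_succ_apply]; exact hk
      have hchain' : ∀ j, j ≤ k' → par^[j] (par o) ∈ T := by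
        intro j hj; rw [← Function.iterate_succ_apply]; exact hchain (j + 1) (by omega)
      exact IH _ (by omega) T par dep w (par o) k' P le_rfl hk' hchain' hA t' hEN' hcut'

/-- **UNCONDITIONAL for at most seven relays, any tree observer**: layer one of FAR from a tree observer (tree hanging at `c_0`) of a pendant forest on a
cycle with `|A| ≤ 7`, by the kernel sun certificates. [this work] -/
theorem layerOne_of_pforest_treeObs_of_card_le_seven {T : Finset (Fin n)} {par : Fin n → Fin n} {dep : Fin n → ℕ}
    {w : Sym2 (Fin n) → unitInterval} (P : PForest L cyc idx T par dep w) (A : Finset (Fin n)) (h7 : A.card ≤ 7)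
    (hA : ∀ a ∈ A, a ∈ T ∨ ∃ i, i < L ∧ a = cyc i) {o : Fin n} {k : ℕ} (hk : par^[k + 1] o = cyc 0) (hchain : ∀ j, j ≤ k → par^[j] o ∈ T)
    (t : ℝ) (hEN : (2 : ℝ) < ∑ a ∈ A, (prodBernoulli w).real (openConn o a))
    (hcut : ∀ a ∈ A, (prodBernoulli w).real (openConn o a : Set (BondConfig (Fin n)))ᶜ ≤ t) :
    (prodBernoulli w).real {ω : BondConfig (Fin n) | (A.filter fun a => ω ∈ openConn o a).card ≤ 1} ≤ t := by
  have hK : 2 ≤ A.card := by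
    have hle : ∑ a ∈ A, (prodBernoulli w).real (openConn o a) ≤ ∑ _a ∈ A, (1 : ℝ) := sum_le_sum fun a _ => measureReal_le_one
    rw [sum_const, nsmul_eq_mul, mul_one] at hle
    have : (2 : ℝ) < A.card := by linarith
    exact_mod_cast this.le
  exact layerOne_of_pforest_treeObs A (HairyCycle.sunFAR_of_le_seven hK h7 1) _ T par dep w o k P le_rfl hk hchain hA t hEN hcut

end TreeObsCard

end Bundle

end Quant

end Summit.CriticalPhenomena.PercolationContinuityZ3.Theorems
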